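import Summits.CriticalPhenomena.CardyFormulaZ2.Theorems.CardyBoundaryCoulombGasBoundaryDefectGaussianRS17ConfigsNonemptyPart12

/-!
# Stub `s17_eventually_configsNonempty` of the D2 completion (line
# `rainbow-monomials-in-excursion-kernels`, crux `BoundaryDefectGaussianR`,
# stmt-CriticalPhenomena-14132) — Part 13: the prescribed levels of the jump collar are
# 1-Lipschitz; a height configuration exists (lattice form)

**Theorem** (`configsNonempty_of_flat_chart`, registered one-line form
`s17_configsNonempty_part13`). Let `ι` be ADMISSIBLE on `V` with `L = sinkLegs`, its insertion
points FLAT at radius `sinkLegs + (9 L + 20)`, and every boundary vertex of `V` carrying a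
half-plane / convex / reflex lattice chart of sup-radius `2 L + 8` (BIGCHART). Then the jump collar
`ι.model V` has a height configuration: `(ι.model V).configs.Nonempty`.

Proof. By Part 1 it suffices that the prescribed levels be odd / even with the right signs (Part 7)
and 1-Lipschitz for the cell distance `D` (sup-norm of doubled positions). For two prescribed cells
`c, c'`: all levels lie in `[-L, 0]`, so only `D < L` matters. Anchor `c` at a cycle dart `ds[t]`
next to it carrying its level (Part 7; a face never met by the walk cannot be that close to the
walk, Part 12), and likewise `c'` at `ds[t']`, whose vertex is then within `L + 2` of that of
`ds[t]`. If no insertion point is within `4 L + 6` of the vertex of `ds[t]`, the four states at `t`,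
`t'` carry one level (Part 12, the silent case): the two levels agree. Otherwise both cells lie in
the straight strip of that insertion point and the one-dimensional count applies (Part 11):
`gl_vv`, `gl_vf`, `gl_ff`. All [folklore].
-/

namespace Summit.CriticalPhenomena.CardyFormulaZ2.Cruxes.BoundaryDefectGaussianR.RainbowMonomialsInExcursionKernels

open Literature.Probability.LatticeModels Literature.Probability.LatticeModels.CollarLegModel

section Admissible

variable (ι : LegInsertionData) (V : Finset (ℤ × ℤ)) {d₀ : Dart} (hadm : ι.IsAdmissible V)
  (h0 : outDart V ι.sink = some d₀) {st : ℕ → WalkState}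
  (hst : ∀ t, st t = List.foldl (fun s d => s.step (ι.startAt V d)) ι.init ((cycle V d₀).take t))
  (hBC : ∀ u ∈ V, ∀ k : Fin 4, u + dir k ∉ V → ∃ (K : Fin 4) (c₁ c₂ : ℤ),
    (∀ v : ℤ × ℤ, |v.1 - u.1| ≤ ((2 * ι.sinkLegs + 8 : ℕ) : ℤ) → |v.2 - u.2| ≤ ((2 * ι.sinkLegs + 8 : ℕ) : ℤ) →
      (v ∈ V ↔ c₂ ≤ v.1 * (dir (K + 1)).1 + v.2 * (dir (K + 1)).2)) ∨
    (∀ v : ℤ × ℤ, |v.1 - u.1| ≤ ((2 * ι.sinkLegs + 8 : ℕ) : ℤ) → |v.2 - u.2| ≤ ((2 * ι.sinkLegs + 8 : ℕ) : ℤ) →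
      (v ∈ V ↔ c₁ ≤ v.1 * (dir K).1 + v.2 * (dir K).2 ∧
        c₂ ≤ v.1 * (dir (K + 1)).1 + v.2 * (dir (K + 1)).2)) ∨
    (∀ v : ℤ × ℤ, |v.1 - u.1| ≤ ((2 * ι.sinkLegs + 8 : ℕ) : ℤ) → |v.2 - u.2| ≤ ((2 * ι.sinkLegs + 8 : ℕ) : ℤ) →
      (v ∈ V ↔ c₂ ≤ v.1 * (dir (K + 1)).1 + v.2 * (dir (K + 1)).2 ∨
        v.1 * (dir K).1 + v.2 * (dir K).2 ≤ c₁)))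
  (hFL : ∀ x ∈ insert ι.sink ι.source, ∃ dvec : ℤ × ℤ,
    (dvec = (1, 0) ∨ dvec = (-1, 0) ∨ dvec = (0, 1) ∨ dvec = (0, -1)) ∧
    ∀ v : ℤ × ℤ, (v.1 - x.1) ^ 2 + (v.2 - x.2) ^ 2 ≤ ((ι.sinkLegs : ℤ) + (9 * ι.sinkLegs + 20)) ^ 2 →
      (v ∈ V ↔ 0 ≤ (v.1 - x.1) * dvec.1 + (v.2 - x.2) * dvec.2))

include hadm h0 hst hBC hFL in
/-- **The strip case, from a nearby insertion point.** If an insertion point `x₀` is within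
sup-distance `4 L + 6` of the vertex of the cycle dart `ds[t]`, two prescribed cells whose doubled
positions are within `2` resp. `L + 1` of `2 ds[t].1` resp. of each other satisfy the three
Lipschitz inequalities (Part 11 on the strip of `x₀`). [folklore] -/
theorem gl_stripCase {t : ℕ} (ht : t < (cycle V d₀).length) {x₀ : ℤ × ℤ}
    (hx₀ : x₀ ∈ insert ι.sink ι.source)
    (hx₀n : |((cycle V d₀)[t]).1.1 - x₀.1| ≤ 4 * ι.sinkLegs + 6 ∧
      |((cycle V d₀)[t]).1.2 - x₀.2| ≤ 4 * ι.sinkLegs + 6) :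
    (∀ x y : ℤ × ℤ, x ∈ (ι.model V).vertexCells → (x, false) ∉ (ι.model V).freeCells →
      y ∈ (ι.model V).vertexCells → (y, false) ∉ (ι.model V).freeCells →
      |2 * x.1 - 2 * ((cycle V d₀)[t]).1.1| ≤ 2 → |2 * x.2 - 2 * ((cycle V d₀)[t]).1.2| ≤ 2 →
      |2 * x.1 - 2 * y.1| ≤ ι.sinkLegs + 1 → |2 * x.2 - 2 * y.2| ≤ ι.sinkLegs + 1 →
      |(ι.model V).C.vertH x - (ι.model V).C.vertH y| ≤ max |2 * x.1 - 2 * y.1| |2 * x.2 - 2 * y.2|) ∧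
    (∀ x g : ℤ × ℤ, x ∈ (ι.model V).vertexCells → (x, false) ∉ (ι.model V).freeCells →
      g ∈ (ι.model V).faceCells → (g, true) ∉ (ι.model V).freeCells →
      |2 * x.1 - 2 * ((cycle V d₀)[t]).1.1| ≤ 2 → |2 * x.2 - 2 * ((cycle V d₀)[t]).1.2| ≤ 2 →
      |2 * x.1 - (2 * g.1 + 1)| ≤ ι.sinkLegs + 1 → |2 * x.2 - (2 * g.2 + 1)| ≤ ι.sinkLegs + 1 →
      |(ι.model V).C.vertH x - (ι.model V).C.faceH g| ≤
        max |2 * x.1 - (2 * g.1 + 1)| |2 * x.2 - (2 * g.2 + 1)|) ∧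
    (∀ f g : ℤ × ℤ, f ∈ (ι.model V).faceCells → (f, true) ∉ (ι.model V).freeCells →
      g ∈ (ι.model V).faceCells → (g, true) ∉ (ι.model V).freeCells →
      |2 * f.1 + 1 - 2 * ((cycle V d₀)[t]).1.1| ≤ 2 → |2 * f.2 + 1 - 2 * ((cycle V d₀)[t]).1.2| ≤ 2 →
      |2 * f.1 - 2 * g.1| ≤ ι.sinkLegs + 1 → |2 * f.2 - 2 * g.2| ≤ ι.sinkLegs + 1 →
      |(ι.model V).C.faceH f - (ι.model V).C.faceH g| ≤ max |2 * f.1 - 2 * g.1| |2 * f.2 - 2 * g.2|) := by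
  obtain ⟨s₀, hs₀, hxs₀⟩ := gl_insertion_dart ι V hadm h0 hx₀
  obtain ⟨⟨x₀', k₀⟩, hds₀⟩ : ∃ q : Dart, (cycle V d₀)[s₀] = q := ⟨_, rfl⟩
  have : x₀' = x₀ := by rw [hds₀] at hxs₀; exact hxs₀
  subst this
  obtain ⟨dvec, hd, hfl⟩ := hFL x₀' hx₀
  have hCH := gl_chart3 (by omega) hBC
  have hL1 : 1 ≤ ι.sinkLegs := sinkLegs_pos ι V hadm
  have hR : (4 : ℤ) ≤ (ι.sinkLegs : ℤ) + (9 * ι.sinkLegs + 20) := by omega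
  set A : ℤ := 5 * ι.sinkLegs + 7 with hAdef
  have hA : 0 ≤ A := by omega
  have hAR : 2 * A + 6 ≤ (ι.sinkLegs : ℤ) + (9 * ι.sinkLegs + 20) := by rw [hAdef]; ring_nf; omega
  have hlev : ∀ e, (fun e => (st ((s₀ + (cycle V d₀).length * ((ι.sinkLegs : ℤ) + (9 * ι.sinkLegs + 20) - 2).toNat -
      ((ι.sinkLegs : ℤ) + (9 * ι.sinkLegs + 20) - 2).toNat + e) % (cycle V d₀).length)).level) e =
      (st ((s₀ + (cycle V d₀).length * ((ι.sinkLegs : ℤ) + (9 * ι.sinkLegs + 20) - 2).toNat -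
      ((ι.sinkLegs : ℤ) + (9 * ι.sinkLegs + 20) - 2).toNat + e) % (cycle V d₀).length)).level := fun _ => rfl
  obtain ⟨u1, u2⟩ := hx₀n
  rw [abs_le] at u1 u2
  refine ⟨?_, ?_, ?_⟩
  · intro x y hx hxf hy hyf hx1 hx2 hxy1 hxy2
    rw [abs_le] at hx1 hx2 hxy1 hxy2
    have hxn : |2 * x.1 - 2 * x₀'.1| ≤ 2 * A ∧ |2 * x.2 - 2 * x₀'.2| ≤ 2 * A := by
      constructor <;> rw [abs_le] <;> constructor <;> omega
    have hyn : |2 * y.1 - 2 * x₀'.1| ≤ 2 * A ∧ |2 * y.2 - 2 * x₀'.2| ≤ 2 * A := by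
      constructor <;> rw [abs_le] <;> constructor <;> omega
    have h1 := sl_vv ι V hadm h0 hst hs₀ hds₀ hd hfl hR _ hlev hA hAR hx hxf hy hyf hxn hyn
    have h2 := sl_vv ι V hadm h0 hst hs₀ hds₀ hd hfl hR _ hlev hA hAR hy hyf hx hxf hyn hxn
    rw [abs_sub_comm (2 * y.1), abs_sub_comm (2 * y.2)] at h2
    rw [abs_le]; constructor <;> linarith
  · intro x g hx hxf hg hgf hx1 hx2 hxy1 hxy2
    rw [abs_le] at hx1 hx2 hxy1 hxy2
    have hxn : |2 * x.1 - 2 * x₀'.1| ≤ 2 * A ∧ |2 * x.2 - 2 * x₀'.2| ≤ 2 * A := by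
      constructor <;> rw [abs_le] <;> constructor <;> omega
    have hgn : |2 * g.1 + 1 - 2 * x₀'.1| ≤ 2 * A ∧ |2 * g.2 + 1 - 2 * x₀'.2| ≤ 2 * A := by
      constructor <;> rw [abs_le] <;> constructor <;> omega
    exact sl_vf ι V hadm h0 hst hCH hs₀ hds₀ hd hfl hR _ hlev hA hAR hx hxf hg hgf hxn hgn
  · intro f g hf hff hg hgf hf1 hf2 hfg1 hfg2
    rw [abs_le] at hf1 hf2 hfg1 hfg2
    have hfn : |2 * f.1 + 1 - 2 * x₀'.1| ≤ 2 * A ∧ |2 * f.2 + 1 - 2 * x₀'.2| ≤ 2 * A := by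
      constructor <;> rw [abs_le] <;> constructor <;> omega
    have hgn : |2 * g.1 + 1 - 2 * x₀'.1| ≤ 2 * A ∧ |2 * g.2 + 1 - 2 * x₀'.2| ≤ 2 * A := by
      constructor <;> rw [abs_le] <;> constructor <;> omega
    have h1 := sl_ff ι V hadm h0 hst hCH hs₀ hds₀ hd hfl hR _ hlev hA hAR hf hff hg hgf hfn hgn
    have h2 := sl_ff ι V hadm h0 hst hCH hs₀ hds₀ hd hfl hR _ hlev hA hAR hg hgf hf hff hgn hfn
    rw [abs_sub_comm (2 * g.1), abs_sub_comm (2 * g.2)] at h2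
    rw [abs_le]; constructor <;> linarith

include hadm h0 hst hBC hFL in
/-- **Vertex against vertex.** [folklore] -/
theorem gl_vv {x y : ℤ × ℤ} (hx : x ∈ (ι.model V).vertexCells) (hxf : (x, false) ∉ (ι.model V).freeCells)
    (hy : y ∈ (ι.model V).vertexCells) (hyf : (y, false) ∉ (ι.model V).freeCells) :
    (ι.model V).C.vertH x - (ι.model V).C.vertH y ≤ max |2 * x.1 - 2 * y.1| |2 * x.2 - 2 * y.2| := by
  have hCH := gl_chart3 (by omega) hBC
  have hFL3 := gl_flat_mono ι V (R₁ := 3) (by omega) (by omega) hFL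
  obtain ⟨t, ht, hxt, hlevx⟩ := pc_vertex_touch ι V hadm h0 hst hFL3 hCH hx hxf
  obtain ⟨t', ht', hyt, hlevy⟩ := pc_vertex_touch ι V hadm h0 hst hFL3 hCH hy hyf
  -- levels lie in `[-L, 0]`
  have bx : -(ι.sinkLegs : ℤ) ≤ (ι.model V).C.vertH x ∧ (ι.model V).C.vertH x ≤ 0 := by
    rcases hlevx with ⟨-, h⟩ | ⟨-, h⟩ <;> rw [h]
    · exact st_level_mem ι V hadm h0 hst ht.le
    · exact st_level_mem ι V hadm h0 hst (by omega)
  have bY : -(ι.sinkLegs : ℤ) ≤ (ι.model V).C.vertH y ∧ (ι.model V).C.vertH y ≤ 0 := by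
    rcases hlevy with ⟨-, h⟩ | ⟨-, h⟩ <;> rw [h]
    · exact st_level_mem ι V hadm h0 hst ht'.le
    · exact st_level_mem ι V hadm h0 hst (by omega)
  by_cases hD : (ι.sinkLegs : ℤ) ≤ max |2 * x.1 - 2 * y.1| |2 * x.2 - 2 * y.2|
  · linarith [bx.2, bY.1]
  push Not at hD
  have hD1 : |2 * x.1 - 2 * y.1| ≤ ι.sinkLegs + 1 := by
    have := le_max_left |2 * x.1 - 2 * y.1| |2 * x.2 - 2 * y.2|; omega
  have hD2 : |2 * x.2 - 2 * y.2| ≤ ι.sinkLegs + 1 := by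
    have := le_max_right |2 * x.1 - 2 * y.1| |2 * x.2 - 2 * y.2|; omega
  have hx1 : |2 * x.1 - 2 * ((cycle V d₀)[t]).1.1| ≤ 2 := (le_max_left _ _).trans hxt
  have hx2 : |2 * x.2 - 2 * ((cycle V d₀)[t]).1.2| ≤ 2 := (le_max_right _ _).trans hxt
  by_cases hfar : ∀ x₀ ∈ insert ι.sink ι.source,
      4 * (ι.sinkLegs : ℤ) + 7 ≤ |((cycle V d₀)[t]).1.1 - x₀.1| ∨
        4 * (ι.sinkLegs : ℤ) + 7 ≤ |((cycle V d₀)[t]).1.2 - x₀.2|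
  · -- the silent case
    have hy1 : |2 * y.1 - 2 * ((cycle V d₀)[t']).1.1| ≤ 2 := (le_max_left _ _).trans hyt
    have hy2 : |2 * y.2 - 2 * ((cycle V d₀)[t']).1.2| ≤ 2 := (le_max_right _ _).trans hyt
    have hnear : |((cycle V d₀)[t']).1.1 - ((cycle V d₀)[t]).1.1| ≤ ((ι.sinkLegs + 2 : ℕ) : ℤ) ∧
        |((cycle V d₀)[t']).1.2 - ((cycle V d₀)[t]).1.2| ≤ ((ι.sinkLegs + 2 : ℕ) : ℤ) := by
      rw [abs_le] at hx1 hx2 hy1 hy2 hD1 hD2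
      push_cast
      constructor <;> rw [abs_le] <;> constructor <;> omega
    obtain ⟨e1, e2, e3⟩ := gl_caseA ι V hadm h0 hst hBC (Rx := 9 * ι.sinkLegs + 20) (by omega) hFL ht
      hfar ht' hnear
    have hxv : (ι.model V).C.vertH x = (st t).level := by
      rcases hlevx with ⟨-, h⟩ | ⟨-, h⟩
      · exact h
      · rw [h, e1]
    have hyv : (ι.model V).C.vertH y = (st t).level := by
      rcases hlevy with ⟨-, h⟩ | ⟨-, h⟩
      · rw [h, e2]
      · rw [h, e3]
    rw [hxv, hyv, sub_self]
    exact le_trans (abs_nonneg _) (le_max_left _ _)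
  · -- the strip case
    push Not at hfar
    obtain ⟨x₀, hx₀, n1, n2⟩ := hfar
    obtain ⟨H, -, -⟩ := gl_stripCase ι V hadm h0 hst hBC hFL ht hx₀ ⟨by omega, by omega⟩
    exact (le_abs_self _).trans (H x y hx hxf hy hyf hx1 hx2 hD1 hD2)

include hadm h0 hst hBC hFL in
/-- **Vertex against face.** [folklore] -/
theorem gl_vf {x g : ℤ × ℤ} (hx : x ∈ (ι.model V).vertexCells) (hxf : (x, false) ∉ (ι.model V).freeCells)
    (hg : g ∈ (ι.model V).faceCells) (hgf : (g, true) ∉ (ι.model V).freeCells) :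
    |(ι.model V).C.vertH x - (ι.model V).C.faceH g| ≤
      max |2 * x.1 - (2 * g.1 + 1)| |2 * x.2 - (2 * g.2 + 1)| := by
  have hCH := gl_chart3 (by omega) hBC
  have hFL3 := gl_flat_mono ι V (R₁ := 3) (by omega) (by omega) hFL
  obtain ⟨t, ht, hxt, hlevx⟩ := pc_vertex_touch ι V hadm h0 hst hFL3 hCH hx hxf
  have bx : -(ι.sinkLegs : ℤ) ≤ (ι.model V).C.vertH x ∧ (ι.model V).C.vertH x ≤ 0 := by
    rcases hlevx with ⟨-, h⟩ | ⟨-, h⟩ <;> rw [h]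
    · exact st_level_mem ι V hadm h0 hst ht.le
    · exact st_level_mem ι V hadm h0 hst (by omega)
  have bG : -(ι.sinkLegs : ℤ) ≤ (ι.model V).C.faceH g ∧ (ι.model V).C.faceH g ≤ 0 := by
    rcases pc_face_touch ι V hadm h0 hst hCH hgf with ⟨t', ht', -, -, h⟩ | ⟨h, -⟩ <;> rw [h]
    · exact st_level_mem ι V hadm h0 hst (by omega)
    · constructor <;> omega
  by_cases hD : (ι.sinkLegs : ℤ) ≤ max |2 * x.1 - (2 * g.1 + 1)| |2 * x.2 - (2 * g.2 + 1)|
  · rw [abs_le]; constructor <;> linarith [bx.1, bx.2, bG.1, bG.2]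
  push Not at hD
  have hD1 : |2 * x.1 - (2 * g.1 + 1)| ≤ ι.sinkLegs + 1 := by
    have := le_max_left |2 * x.1 - (2 * g.1 + 1)| |2 * x.2 - (2 * g.2 + 1)|; omega
  have hD2 : |2 * x.2 - (2 * g.2 + 1)| ≤ ι.sinkLegs + 1 := by
    have := le_max_right |2 * x.1 - (2 * g.1 + 1)| |2 * x.2 - (2 * g.2 + 1)|; omega
  have hx1 : |2 * x.1 - 2 * ((cycle V d₀)[t]).1.1| ≤ 2 := (le_max_left _ _).trans hxt
  have hx2 : |2 * x.2 - 2 * ((cycle V d₀)[t]).1.2| ≤ 2 := (le_max_right _ _).trans hxt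
  by_cases hfar : ∀ x₀ ∈ insert ι.sink ι.source,
      4 * (ι.sinkLegs : ℤ) + 7 ≤ |((cycle V d₀)[t]).1.1 - x₀.1| ∨
        4 * (ι.sinkLegs : ℤ) + 7 ≤ |((cycle V d₀)[t]).1.2 - x₀.2|
  · -- the silent case: `g` is met by the walk near `ds[t]`
    have hgn : |2 * g.1 + 1 - 2 * ((cycle V d₀)[t]).1.1| ≤ 2 * ι.sinkLegs + 3 ∧
        |2 * g.2 + 1 - 2 * ((cycle V d₀)[t]).1.2| ≤ 2 * ι.sinkLegs + 3 := by
      rw [abs_le] at hx1 hx2 hD1 hD2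
      constructor <;> rw [abs_le] <;> constructor <;> omega
    obtain ⟨t', ht', hgt', -, hgv⟩ := gl_face_visited ι V hadm h0 hst hBC ht hg hgf hgn
    obtain ⟨g1, g2⟩ := gl_dist_gapFace ((cycle V d₀)[t']).1 ((cycle V d₀)[t']).2
    rw [Prod.mk.eta, hgt'] at g1 g2
    have hnear : |((cycle V d₀)[t']).1.1 - ((cycle V d₀)[t]).1.1| ≤ ((ι.sinkLegs + 2 : ℕ) : ℤ) ∧
        |((cycle V d₀)[t']).1.2 - ((cycle V d₀)[t]).1.2| ≤ ((ι.sinkLegs + 2 : ℕ) : ℤ) := by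
      rw [abs_le] at hx1 hx2 g1 g2 hD1 hD2
      push_cast
      constructor <;> rw [abs_le] <;> constructor <;> omega
    obtain ⟨e1, -, e3⟩ := gl_caseA ι V hadm h0 hst hBC (Rx := 9 * ι.sinkLegs + 20) (by omega) hFL ht
      hfar ht' hnear
    have hxv : (ι.model V).C.vertH x = (st t).level := by
      rcases hlevx with ⟨-, h⟩ | ⟨-, h⟩
      · exact h
      · rw [h, e1]
    rw [hxv, hgv, e3, sub_self, abs_zero]
    exact le_trans (abs_nonneg _) (le_max_left _ _)
  · -- the strip case
    push Not at hfar
    obtain ⟨x₀, hx₀, n1, n2⟩ := hfar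
    obtain ⟨-, H, -⟩ := gl_stripCase ι V hadm h0 hst hBC hFL ht hx₀ ⟨by omega, by omega⟩
    exact H x g hx hxf hg hgf hx1 hx2 hD1 hD2

include hadm h0 hst hBC hFL in
/-- **Face against face.** [folklore] -/
theorem gl_ff {f g : ℤ × ℤ} (hf : f ∈ (ι.model V).faceCells) (hff : (f, true) ∉ (ι.model V).freeCells)
    (hg : g ∈ (ι.model V).faceCells) (hgf : (g, true) ∉ (ι.model V).freeCells) :
    |(ι.model V).C.faceH f - (ι.model V).C.faceH g| ≤ max |2 * f.1 - 2 * g.1| |2 * f.2 - 2 * g.2| := by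
  have hCH := gl_chart3 (by omega) hBC
  have bd : ∀ {f' : ℤ × ℤ}, (f', true) ∉ (ι.model V).freeCells →
      -(ι.sinkLegs : ℤ) ≤ (ι.model V).C.faceH f' ∧ (ι.model V).C.faceH f' ≤ 0 := by
    intro f' hf'
    rcases pc_face_touch ι V hadm h0 hst hCH hf' with ⟨t', ht', -, -, h⟩ | ⟨h, -⟩ <;> rw [h]
    · exact st_level_mem ι V hadm h0 hst (by omega)
    · constructor <;> omega
  by_cases hD : (ι.sinkLegs : ℤ) ≤ max |2 * f.1 - 2 * g.1| |2 * f.2 - 2 * g.2|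
  · rw [abs_le]; constructor <;> linarith [(bd hff).1, (bd hff).2, (bd hgf).1, (bd hgf).2]
  push Not at hD
  have hD1 : |2 * f.1 - 2 * g.1| ≤ ι.sinkLegs + 1 := by
    have := le_max_left |2 * f.1 - 2 * g.1| |2 * f.2 - 2 * g.2|; omega
  have hD2 : |2 * f.2 - 2 * g.2| ≤ ι.sinkLegs + 1 := by
    have := le_max_right |2 * f.1 - 2 * g.1| |2 * f.2 - 2 * g.2|; omega
  -- anchor one of the two faces at a cycle dart (if neither is met by the walk, both levels are `0`)
  suffices KEY : ∀ f g : ℤ × ℤ, f ∈ (ι.model V).faceCells → (f, true) ∉ (ι.model V).freeCells →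
      g ∈ (ι.model V).faceCells → (g, true) ∉ (ι.model V).freeCells →
      |2 * f.1 - 2 * g.1| ≤ ι.sinkLegs + 1 → |2 * f.2 - 2 * g.2| ≤ ι.sinkLegs + 1 →
      (∃ t, ∃ ht : t < (cycle V d₀).length, gapFace (cycle V d₀)[t] = f ∧
        (st (t + 1)).wired = false ∧ (ι.model V).C.faceH f = (st (t + 1)).level) →
      |(ι.model V).C.faceH f - (ι.model V).C.faceH g| ≤ max |2 * f.1 - 2 * g.1| |2 * f.2 - 2 * g.2| by
    rcases pc_face_touch ι V hadm h0 hst hCH hff with hvis | ⟨hf0, -⟩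
    · exact KEY f g hf hff hg hgf hD1 hD2 hvis
    rcases pc_face_touch ι V hadm h0 hst hCH hgf with hvis | ⟨hg0, -⟩
    · have := KEY g f hg hgf hf hff (by rw [abs_sub_comm]; exact hD1) (by rw [abs_sub_comm]; exact hD2) hvis
      rwa [abs_sub_comm, abs_sub_comm (2 * g.1), abs_sub_comm (2 * g.2)] at this
    · rw [hf0, hg0, sub_self, abs_zero]
      exact le_trans (abs_nonneg _) (le_max_left _ _)
  rintro f g hf hff hg hgf hD1 hD2 ⟨t, ht, hft, -, hfv⟩
  obtain ⟨f1, f2⟩ := gl_dist_gapFace ((cycle V d₀)[t]).1 ((cycle V d₀)[t]).2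
  rw [Prod.mk.eta, hft] at f1 f2
  by_cases hfar : ∀ x₀ ∈ insert ι.sink ι.source,
      4 * (ι.sinkLegs : ℤ) + 7 ≤ |((cycle V d₀)[t]).1.1 - x₀.1| ∨
        4 * (ι.sinkLegs : ℤ) + 7 ≤ |((cycle V d₀)[t]).1.2 - x₀.2|
  · have hgn : |2 * g.1 + 1 - 2 * ((cycle V d₀)[t]).1.1| ≤ 2 * ι.sinkLegs + 3 ∧
        |2 * g.2 + 1 - 2 * ((cycle V d₀)[t]).1.2| ≤ 2 * ι.sinkLegs + 3 := by
      rw [abs_le] at f1 f2 hD1 hD2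
      constructor <;> rw [abs_le] <;> constructor <;> omega
    obtain ⟨t', ht', hgt', -, hgv⟩ := gl_face_visited ι V hadm h0 hst hBC ht hg hgf hgn
    obtain ⟨g1, g2⟩ := gl_dist_gapFace ((cycle V d₀)[t']).1 ((cycle V d₀)[t']).2
    rw [Prod.mk.eta, hgt'] at g1 g2
    have hnear : |((cycle V d₀)[t']).1.1 - ((cycle V d₀)[t]).1.1| ≤ ((ι.sinkLegs + 2 : ℕ) : ℤ) ∧
        |((cycle V d₀)[t']).1.2 - ((cycle V d₀)[t]).1.2| ≤ ((ι.sinkLegs + 2 : ℕ) : ℤ) := by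
      rw [abs_le] at f1 f2 g1 g2 hD1 hD2
      push_cast
      constructor <;> rw [abs_le] <;> constructor <;> omega
    obtain ⟨e1, -, e3⟩ := gl_caseA ι V hadm h0 hst hBC (Rx := 9 * ι.sinkLegs + 20) (by omega) hFL ht
      hfar ht' hnear
    rw [hfv, hgv, e1, e3, sub_self, abs_zero]
    exact le_trans (abs_nonneg _) (le_max_left _ _)
  · push Not at hfar
    obtain ⟨x₀, hx₀, n1, n2⟩ := hfar
    obtain ⟨-, -, H⟩ := gl_stripCase ι V hadm h0 hst hBC hFL ht hx₀ ⟨by omega, by omega⟩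
    exact H f g hf hff hg hgf (f1.trans (by norm_num)) (f2.trans (by norm_num)) hD1 hD2

end Admissible

/-- **A height configuration exists (lattice form).** For an ADMISSIBLE leg insertion whose
insertion points are flat at radius `sinkLegs + (9 sinkLegs + 20)` on a `V` whose boundary vertices
carry half-plane / convex / reflex lattice charts of sup-radius `2 sinkLegs + 8`, the jump collar
has a valid height configuration. [folklore] -/
theorem configsNonempty_of_flat_chart (ι : LegInsertionData) (V : Finset (ℤ × ℤ)) (hadm : ι.IsAdmissible V)
    (hBC : ∀ u ∈ V, ∀ k : Fin 4, u + dir k ∉ V → ∃ (K : Fin 4) (c₁ c₂ : ℤ),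
      (∀ v : ℤ × ℤ, |v.1 - u.1| ≤ ((2 * ι.sinkLegs + 8 : ℕ) : ℤ) → |v.2 - u.2| ≤ ((2 * ι.sinkLegs + 8 : ℕ) : ℤ) →
        (v ∈ V ↔ c₂ ≤ v.1 * (dir (K + 1)).1 + v.2 * (dir (K + 1)).2)) ∨
      (∀ v : ℤ × ℤ, |v.1 - u.1| ≤ ((2 * ι.sinkLegs + 8 : ℕ) : ℤ) → |v.2 - u.2| ≤ ((2 * ι.sinkLegs + 8 : ℕ) : ℤ) →
        (v ∈ V ↔ c₁ ≤ v.1 * (dir K).1 + v.2 * (dir K).2 ∧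
          c₂ ≤ v.1 * (dir (K + 1)).1 + v.2 * (dir (K + 1)).2)) ∨
      (∀ v : ℤ × ℤ, |v.1 - u.1| ≤ ((2 * ι.sinkLegs + 8 : ℕ) : ℤ) → |v.2 - u.2| ≤ ((2 * ι.sinkLegs + 8 : ℕ) : ℤ) →
        (v ∈ V ↔ c₂ ≤ v.1 * (dir (K + 1)).1 + v.2 * (dir (K + 1)).2 ∨
          v.1 * (dir K).1 + v.2 * (dir K).2 ≤ c₁)))
    (hFL : ∀ x ∈ insert ι.sink ι.source, ∃ dvec : ℤ × ℤ,
      (dvec = (1, 0) ∨ dvec = (-1, 0) ∨ dvec = (0, 1) ∨ dvec = (0, -1)) ∧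
      ∀ v : ℤ × ℤ, (v.1 - x.1) ^ 2 + (v.2 - x.2) ^ 2 ≤ ((ι.sinkLegs : ℤ) + (9 * ι.sinkLegs + 20)) ^ 2 →
        (v ∈ V ↔ 0 ≤ (v.1 - x.1) * dvec.1 + (v.2 - x.2) * dvec.2)) :
    (ι.model V).configs.Nonempty := by
  obtain ⟨d₀, h0, -, -, -, -⟩ := s3_of_admissible ι V hadm
  have hst : ∀ t, (fun t => List.foldl (fun s d => s.step (ι.startAt V d)) ι.init
      ((cycle V d₀).take t)) t = List.foldl (fun s d => s.step (ι.startAt V d)) ι.init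
      ((cycle V d₀).take t) := fun _ => rfl
  have hCH := gl_chart3 (by omega) hBC
  have hFL3 := gl_flat_mono ι V (R₁ := 3) (by omega) (by omega) hFL
  obtain ⟨hpv, hpf⟩ := pc_parity ι V hadm h0 hst hFL3 hCH
  refine configsNonempty_of_lipschitz (ι.model V) hpv hpf ?_ ?_ ?_
  · intro x hx hxf y hy hyf
    exact gl_vv ι V hadm h0 hst hBC hFL hx hxf hy hyf
  · intro x hx hxf g hg hgf
    exact gl_vf ι V hadm h0 hst hBC hFL hx hxf hg hgf
  · intro f hf hff g hg hgf
    exact (le_abs_self _).trans (gl_ff ι V hadm h0 hst hBC hFL hf hff hg hgf)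

/-! ### Registered one-line form -/

/-- **Registered sub-goal `s17_configsNonempty_part13`** of `s17_eventually_configsNonempty`
(stmt-CriticalPhenomena-14132): for an admissible leg insertion with flat insertion points (radius
`sinkLegs + (9 sinkLegs + 20)`) on a `V` with half-plane / convex / reflex charts of sup-radius
`2 sinkLegs + 8` at its boundary vertices, the jump collar has a height configuration (one-line
form of `configsNonempty_of_flat_chart`). [folklore] -/
theorem s17_configsNonempty_part13 : ∀ (ι : Literature.Probability.LatticeModels.CollarLegModel.LegInsertionData) (V : Finset (ℤ × ℤ)), ι.IsAdmissible V → (∀ u ∈ V, ∀ k : Fin 4, u + Literature.Probability.LatticeModels.CollarLegModel.dir k ∉ V → ∃ (K : Fin 4) (c₁ c₂ : ℤ), (∀ v : ℤ × ℤ, |v.1 - u.1| ≤ ((2 * ι.sinkLegs + 8 : ℕ) : ℤ) → |v.2 - u.2| ≤ ((2 * ι.sinkLegs + 8 : ℕ) : ℤ) → (v ∈ V ↔ c₂ ≤ v.1 * (Literature.Probability.LatticeModels.CollarLegModel.dir (K + 1)).1 + v.2 * (Literature.Probability.LatticeModels.CollarLegModel.dir (K + 1)).2)) ∨ (∀ v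 : ℤ × ℤ, |v.1 - u.1| ≤ ((2 * ι.sinkLegs + 8 : ℕ) : ℤ) → |v.2 - u.2| ≤ ((2 * ι.sinkLegs + 8 : ℕ) : ℤ) → (v ∈ V ↔ c₁ ≤ v.1 * (Literature.Probability.LatticeModels.CollarLegModel.dir K).1 + v.2 * (Literature.Probability.LatticeModels.CollarLegModel.dir K).2 ∧ c₂ ≤ v.1 * (Literature.Probability.LatticeModels.CollarLegModel.dir (K + 1)).1 + v.2 * (Literature.Probability.LatticeModels.CollarLegModel.dir (K + 1)).2)) ∨ (∀ v : ℤ × ℤ, |v.1 - u.1| ≤ ((2 * ι.sinkLegs + 8 : ℕ) : ℤ) → |v.2 - u.2| ≤ ((2 * ι.sinkLegs + 8 : ℕ) : ℤ) → (v ∈ V ↔ c₂ ≤ v.1 * (Literature.Probability.LatticeModels.CollarLegModel.dir (K + 1)).1 + v.2 * (Literature.Probability.LatticeModels.CollarLegModel.dir (K + 1)).2 ∨ v.1 * (Literature.Probability.LatticeModels.CollarLegModel.dir K).1 + v.2 * (Literature.Probability.LatticeModels.CollarLegModel.dir K).2 ≤ c₁))) → (∀ x ∈ insert ι.sink ι.source,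 ∃ dvec : ℤ × ℤ, (dvec = (1, 0) ∨ dvec = (-1, 0) ∨ dvec = (0, 1) ∨ dvec = (0, -1)) ∧ ∀ v : ℤ × ℤ, (v.1 - x.1) ^ 2 + (v.2 - x.2) ^ 2 ≤ ((ι.sinkLegs : ℤ) + (9 * ι.sinkLegs + 20)) ^ 2 → (v ∈ V ↔ 0 ≤ (v.1 - x.1) * dvec.1 + (v.2 - x.2) * dvec.2)) → (Literature.Probability.LatticeModels.CollarLegModel.LegInsertionData.model ι V).configs.Nonempty :=
  fun ι V hadm hBC hFL => configsNonempty_of_flat_chart ι V hadm hBC hFL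

end Summit.CriticalPhenomena.CardyFormulaZ2.Cruxes.BoundaryDefectGaussianR.RainbowMonomialsInExcursionKernels
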